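import Literature.AnabelianGeometry.EtaleTheta.ThetaEnvOfSetting

/-!
# [EtTh] §5 ← §1/§2: when does the mod `N` theta (root) cocycle DIE on a subgroup of `Π^tp_Ÿ̲̲`? — the shape of the binder `hdies` (pp. 313, 322, 330–331 / PDF pp. 87, 96, 104–105)

Mochizuki, *The étale theta function …*, Publ. RIMS **45** (2009)
[cite: MochizukiEtTh2009, Def 4.1 (iii) p.313 (PDF p.87); §5 p.330–331 (PDF pp.104–105); Def 2.13 p.272–273 (PDF pp.46–47)].
abc-iut cell, layer L2, GAP-LEDGER row G-w5d123-1 (L2-lead 02:56:16Z; seat abc-iut-L6-t23, gen 4); PROOF-ONLY (no `def`,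
no new named fact) over abc-iut-L2-t2's `ThetaEnvData` (`MonoThetaEnv.lean`) and abc-iut-L2-t8's instantiation
`ThetaSetting.EtaleThetaData.DoubleUnderline.thetaEnvData` (`ThetaEnvOfSetting.lean`).

THE BINDER.  abc-iut-w5-d123's descent of the mod `N` root cocycle along `ρ : Π^tp_X̲̲ ↠ Aut_D(B_N^bs)`
(`Discharge/Sec5Prop55EtaTautological.lean`, [EtTh] Prop 5.5 / Prop 5.2 (iii)) needs
`hdies : ∀ f ∈ rootCocycles, ∀ k ∈ Π^tp_Ÿ̲̲, ρ k = 1 → (f k mod N) = 1` — "the mod `N` root/theta cocycle is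
trivial on `Π_{B_N} ∩ Π^tp_Ÿ̲̲`".  In print this holds because `A_N^bs = B_N^bs` is the base of an `N`-th root of the
fraction-pair of the `l`-th root of `Θ̈` (§5 p.330 (PDF p.104)) and `A_N` is `(N, H_⊙, f)`-saturated (Def. 4.1 (iii),
p.313 (PDF p.87)): (a) the base field of `A_N` contains `μ_N` ([FrdII] Def. 2.2 (ii)(a)), so `Π_{A_N^bs}` acts
trivially on `μ_N ≅ (l·Δ_Θ) ⊗ ℤ/Nℤ`; (b) `f|_{A_N}` admits an `N`-th root in `O^×(A_N^birat)`, so by Kummer theory the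
mod `N` class of the root of `Θ̈` restricts to `0` on `Π_{A_N^bs}`; and a cocycle with trivial action and trivial class
is trivial.  AT THE CARRIER of abc-iut-L2-t4's `ThetaFrobenioid.ofBiKummerData` (p417743) the map `ρ` is
`rhoOfBiKummerData R ιX = conj((s^⊓_N)^bs) ∘ S.galoisSurj (A_N^bs) ∘ ιX`, whose kernel is the preimage of the kernel of
the ABSTRACT field `BiKummerSetting.galoisSurj` — the carrier does not say which §1 covering `A_N^bs` is, nor does it link
`S.biratUnits` / `NthRoot.isSaturated` to the §1 cohomology; so `hdies` is not literally provided there.  This file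
kernel-settles its exact SHAPE instead (no side taken, nothing asserted):

* `ThetaEnvData.eq_one_of_coboundaryOn_of_chi_eq_one` — (D1) trivial action on `H` + (D2) "the cocycle is a coboundary
  on `H`" ⇒ the cocycle vanishes on `H` (for ANY `μ_N`-valued function);
* `ThetaEnvData.chi_eq_one_of_forall_eq_one` — conversely, if EVERY member of the collection `thetaCocycles` vanishes on
  `H`, then `H` acts trivially on `μ_N` (the collection is closed under coboundary twists, abc-iut-L2-t2's field
  `mul_coboundary_mem`, Def. 2.13 p.273 "conjugation by an element of `μ_N` corresponds precisely to modifying a cocycle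
  by a coboundary") — so the `∀ f`-form of `hdies` CONTAINS (D1), it is not a representative-free weakening;
* `ThetaEnvData.forall_eq_one_iff` — hence, for `H ≤ Π^tp_Ÿ`:
  `(∀ η ∈ thetaCocycles, η|_H = 1) ↔ (D1) ∧ (D2 for every η)`;
* `ThetaEnvData.dies_on_ker_of` — the binder for the kernel of a homomorphism `ρ : Π^tp_X → A` (any `A`; at t4's
  carrier `ρ := rhoOfBiKummerData R ιX`) from (D1)/(D2) on `Ker ρ ∩ Π^tp_Ÿ`;
* `ThetaSetting.EtaleThetaData.DoubleUnderline.modN_eq_one_on_ker_of` — the same read on abc-iut-L2-t8's §1/§2 model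
  `C.thetaEnvData μ hC hS` in the vocabulary of the row (`C.modN μ f _ k = 1` for `f ∈ C.rootCocycles hC`).
The two inputs are then NAMED one level down, each a printed clause of Def. 4.1 (iii) (GAP-LEDGER rows G-L6t23-1 = (D1)
«`Ker ρ ∩ Π^tp_Ÿ̲̲` acts trivially on `μ_N`» ⟸ (iii)(a), G-L6t23-2 = (D2) «the mod `N` class restricts to `0` on
`Ker ρ ∩ Π^tp_Ÿ̲̲`» ⟸ (iii)(b) + the Kummer dictionary), never asserted.  HONEST FRAMING: [EtTh] is refereed; typed ≠ proved;
no side is taken on any disputed claim downstream ([IUTchIII] Cor. 3.12).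
-/

noncomputable section

namespace Literature.AnabelianGeometry.EtaleTheta

/-! ### Generic: vanishing of a cocycle on a subgroup = trivial action + trivial class -/

namespace ThetaEnvData

variable {N : ℕ+} (T : ThetaEnvData N)

/-- **(D1) + (D2) ⇒ pointwise vanishing.**  If a subgroup `H ≤ Π^tp_Ÿ` acts trivially on `μ_N` through
`χ ∘ (Π^tp_Ÿ ↠ G_K)` and a `μ_N`-valued function `η` is, ON `H`, the coboundary of some `c ∈ μ_N`
(`η(k) = c · (k·c)⁻¹`, i.e. its class restricted to `H` is trivial), then `η` vanishes on `H`.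
[cite: MochizukiEtTh2009, Def 2.13 p.273 (PDF p.47)] -/
theorem eq_one_of_coboundaryOn_of_chi_eq_one (H : Subgroup T.PiYdd) (η : T.PiYdd → T.mu)
    (hD1 : ∀ k ∈ H, T.chi (T.aug (k : T.PiX)) = 1)
    (hD2 : ∃ c : T.mu, ∀ k ∈ H, η k = CycEnvelope.coboundary (T.aug.comp T.PiYdd.subtype) T.chi c k) :
    ∀ k ∈ H, η k = 1 := by
  obtain ⟨c, hc⟩ := hD2
  intro k hk
  rw [hc k hk, CycEnvelope.coboundary, MonoidHom.comp_apply, Subgroup.subtype_apply, hD1 k hk,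
    MulAut.one_apply, mul_inv_cancel]

/-- **Pointwise vanishing of the WHOLE collection forces (D1).**  If every member of the collection of mod `N`
theta cocycles vanishes on `H ≤ Π^tp_Ÿ`, then `H` acts trivially on `μ_N`: the collection is nonempty and closed
under multiplication by coboundaries (Def. 2.13, p.273: "conjugation by an element of `μ_N` corresponds precisely to
modifying a cocycle by a coboundary"), so every coboundary vanishes on `H`.
[cite: MochizukiEtTh2009, Def 2.13 p.273 (PDF p.47)] -/
theorem chi_eq_one_of_forall_eq_one (H : Subgroup T.PiYdd)
    (hall : ∀ η ∈ T.thetaCocycles, ∀ k ∈ H, η k = 1) :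
    ∀ k ∈ H, T.chi (T.aug (k : T.PiX)) = 1 := by
  intro k hk
  obtain ⟨η₀, hη₀⟩ := T.thetaCocycles_nonempty
  apply MulEquiv.ext
  intro c
  have h1 := hall η₀ hη₀ k hk
  have h2 := hall _ (T.mul_coboundary_mem η₀ hη₀ c) k hk
  rw [Pi.mul_apply, h1, one_mul, CycEnvelope.coboundary, MonoidHom.comp_apply, Subgroup.subtype_apply,
    mul_inv_eq_one] at h2
  rw [MulAut.one_apply]
  exact h2.symm

/-- **The exact shape of "every mod `N` theta cocycle dies on `H`"**: it is EQUIVALENT to (D1) "`H` acts trivially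
on `μ_N`" together with (D2) "each member restricted to `H` is a coboundary" (with trivial action the only coboundary
is `1`, so (D2) then reads "… vanishes").  [cite: MochizukiEtTh2009, Def 2.13 p.273 (PDF p.47)] -/
theorem forall_eq_one_iff (H : Subgroup T.PiYdd) :
    (∀ η ∈ T.thetaCocycles, ∀ k ∈ H, η k = 1) ↔
      (∀ k ∈ H, T.chi (T.aug (k : T.PiX)) = 1) ∧
        ∀ η ∈ T.thetaCocycles, ∃ c : T.mu,
          ∀ k ∈ H, η k = CycEnvelope.coboundary (T.aug.comp T.PiYdd.subtype) T.chi c k := by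
  constructor
  · intro hall
    refine ⟨T.chi_eq_one_of_forall_eq_one H hall, fun η hη => ⟨1, fun k hk => ?_⟩⟩
    rw [hall η hη k hk, CycEnvelope.coboundary, map_one, inv_one, mul_one]
  · rintro ⟨hD1, hD2⟩ η hη
    exact T.eq_one_of_coboundaryOn_of_chi_eq_one H η hD1 (hD2 η hη)

/-- **The binder `hdies` for the kernel of a homomorphism `ρ` out of `Π^tp_X`** (at abc-iut-L2-t4's carrier:
`ρ := rhoOfBiKummerData R ιX : Π^tp_X ↠ Aut_D(B_N^bs)`, §5 p.331 (PDF p.105), `Ker ρ = Π_{B_N^bs}`): every mod `N`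
theta cocycle dies on `Ker ρ ∩ Π^tp_Ÿ` as soon as (D1) `Ker ρ ∩ Π^tp_Ÿ` acts trivially on `μ_N` — print: the base field
of `A_N` is `μ_N`-saturated, Def. 4.1 (iii)(a) / [FrdII] Def. 2.2 (ii)(a) — and (D2) each member is a coboundary there —
print: `f|_{A_N}` has an `N`-th root, Def. 4.1 (iii)(b), plus Kummer theory.  Both inputs enter BY NAME (GAP rows
G-L6t23-1/2); nothing is asserted.  [cite: MochizukiEtTh2009, Def 4.1 (iii) p.313 (PDF p.87); §5 p.331 (PDF p.105)] -/
theorem dies_on_ker_of {A : Type*} [Group A] (ρ : T.PiX →* A)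
    (hD1 : ∀ k : T.PiYdd, ρ (k : T.PiX) = 1 → T.chi (T.aug (k : T.PiX)) = 1)
    (hD2 : ∀ η ∈ T.thetaCocycles, ∃ c : T.mu, ∀ k : T.PiYdd, ρ (k : T.PiX) = 1 →
      η k = CycEnvelope.coboundary (T.aug.comp T.PiYdd.subtype) T.chi c k) :
    ∀ η ∈ T.thetaCocycles, ∀ k : T.PiYdd, ρ (k : T.PiX) = 1 → η k = 1 := by
  intro η hη k hk
  refine T.eq_one_of_coboundaryOn_of_chi_eq_one (ρ.ker.comap T.PiYdd.subtype) η
    (fun k' hk' => hD1 k' hk') ?_ k hk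
  obtain ⟨c, hc⟩ := hD2 η hη
  exact ⟨c, fun k' hk' => hc k' hk'⟩

/-- Conversely, at such a `ρ`: if every member of the collection dies on `Ker ρ ∩ Π^tp_Ÿ`, then (D1) holds there —
so (D1) is a genuine part of the binder, not an artefact of the chosen representative.
[cite: MochizukiEtTh2009, Def 2.13 p.273 (PDF p.47)] -/
theorem chi_eq_one_on_ker_of_dies {A : Type*} [Group A] (ρ : T.PiX →* A)
    (hdies : ∀ η ∈ T.thetaCocycles, ∀ k : T.PiYdd, ρ (k : T.PiX) = 1 → η k = 1) :
    ∀ k : T.PiYdd, ρ (k : T.PiX) = 1 → T.chi (T.aug (k : T.PiX)) = 1 :=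
  fun k hk => T.chi_eq_one_of_forall_eq_one (ρ.ker.comap T.PiYdd.subtype)
    (fun η hη k' hk' => hdies η hη k' hk') k hk

end ThetaEnvData

/-! ### The same on abc-iut-L2-t8's §1/§2 model `C.thetaEnvData μ hC hS` (vocabulary of the row: `C.modN μ f _ k`) -/

namespace ThetaSetting

namespace EtaleThetaData.DoubleUnderline

open Literature.AnabelianGeometry.SemiGraphs

variable {p : ℕ} [Fact p.Prime] {D : ThetaSetting p} {E : D.EtaleThetaData} {l : ℕ}
  (C : E.DoubleUnderline l) {N : ℕ+} (μ : D.CyclotomeMod l N) (hC : D.Compat) (hS : D.Sec2Hyps)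

/-- **`hdies` at the §1/§2 model, from (D1)/(D2)**: for a homomorphism `ρ` out of `Π^tp_X̲̲ = C.Huu` (at abc-iut-L2-t4's
carrier `ρ := rhoOfBiKummerData R ιX` with `T := C.thetaEnvData μ hC hS`), every mod `N` reduction `C.modN μ f` of a
cocycle `f` of the root orbit `η̲̈^{Θ,l·ℤ×μ₂}` vanishes on `Ker ρ ∩ Π^tp_Ÿ̲̲`, given (D1) that subgroup acts trivially on
`μ_N` and (D2) each reduction is a coboundary there.  [cite: MochizukiEtTh2009, Def 4.1 (iii) p.313 (PDF p.87); Def 2.13 p.272 (PDF p.46)] -/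
theorem modN_eq_one_on_ker_of {A : Type*} [Group A] (ρ : (C.thetaEnvData μ hC hS).PiX →* A)
    (hD1 : ∀ k : (C.thetaEnvData μ hC hS).PiYdd, ρ (k : (C.thetaEnvData μ hC hS).PiX) = 1 →
      (C.thetaEnvData μ hC hS).chi ((C.thetaEnvData μ hC hS).aug (k : (C.thetaEnvData μ hC hS).PiX)) = 1)
    (hD2 : ∀ (f : _) (hf : f ∈ C.rootCocycles hC), ∃ c : MuN p N,
      ∀ k : (C.thetaEnvData μ hC hS).PiYdd, ρ (k : (C.thetaEnvData μ hC hS).PiX) = 1 →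
        C.modN μ f hf.1 k = CycEnvelope.coboundary
          ((C.thetaEnvData μ hC hS).aug.comp (C.thetaEnvData μ hC hS).PiYdd.subtype)
          (C.thetaEnvData μ hC hS).chi c k)
    (f : _) (hf : f ∈ C.rootCocycles hC) (k : (C.thetaEnvData μ hC hS).PiYdd)
    (hk : ρ (k : (C.thetaEnvData μ hC hS).PiX) = 1) : C.modN μ f hf.1 k = 1 :=
  (C.thetaEnvData μ hC hS).dies_on_ker_of ρ hD1
    (by
      rintro η ⟨f', hf', rfl⟩
      exact hD2 f' hf')
    (C.modN μ f hf.1) ⟨f, hf, rfl⟩ k hk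

/-- … and conversely the `∀ f`-form of `hdies` at the model forces (D1) on `Ker ρ ∩ Π^tp_Ÿ̲̲`.
[cite: MochizukiEtTh2009, Def 2.13 p.273 (PDF p.47)] -/
theorem chi_eq_one_on_ker_of_modN_eq_one {A : Type*} [Group A] (ρ : (C.thetaEnvData μ hC hS).PiX →* A)
    (hdies : ∀ (f : _) (hf : f ∈ C.rootCocycles hC) (k : (C.thetaEnvData μ hC hS).PiYdd),
      ρ (k : (C.thetaEnvData μ hC hS).PiX) = 1 → C.modN μ f hf.1 k = 1)
    (k : (C.thetaEnvData μ hC hS).PiYdd) (hk : ρ (k : (C.thetaEnvData μ hC hS).PiX) = 1) :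
    (C.thetaEnvData μ hC hS).chi ((C.thetaEnvData μ hC hS).aug (k : (C.thetaEnvData μ hC hS).PiX)) = 1 :=
  (C.thetaEnvData μ hC hS).chi_eq_one_on_ker_of_dies ρ
    (by
      rintro η ⟨f, hf, rfl⟩ k' hk'
      exact hdies f hf k' hk')
    k hk

end EtaleThetaData.DoubleUnderline

end ThetaSetting

end Literature.AnabelianGeometry.EtaleTheta

end
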